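import Summits.CriticalPhenomena.PercolationContinuityZ3.Theorems.PercNearOneGluingNoHeavyConstsClusterSquareQuadClash
import Summits.CriticalPhenomena.PercolationContinuityZ3.Theorems.PercNearOneGluingNoHeavyConstsClusterSquareUnlinkedIff
import HarnessLib

/-!
# The exact combinatorial content of "no quadruple clash": no cluster of `a` is TERMINAL-LINKED to `{b, c}`

builds on p205010 (kernel theorem, internal audit signed; external expert review pending)

PAPER-2 track "percolation constants", part (ii), seat `prim-consts-1`, gen 24 (lane index
`run/shared/lean/prim/consts/CONSTANTS.md`, row A19).  Support file for the crux `NoHeavyLowerTail` (stmt-CriticalPhenomena-4575;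
`--supports`).  Theorems only; no definitions, no sorries.

Gen 18 (`…ConstsClusterSquareQuadClash.lean`) proved CSQ/DUU at `(a; b, c)` and TS for `{a, b, c}` as soon as no QUADRUPLE CLASH
occurs among configurations of positive pairs: four vertices `y, y', z, z'`, each joined to `K = C_a(ω)` by a positive pair, with
`y, z` in the `b`-cluster and `y', z'` in the `c`-cluster of `ω`, and `y', z` in the `b`-cluster and `y, z'` in the `c`-cluster of the
second configuration `η'` off `K̄` (`b ↮ c` in both).  The graph criteria of gens 18–23 (three boundary vertices, gates, no cross-linkage
= no `W₄` minor with hub `∋ a`, rim roots, apices) forget the terminals.  Here is the EXACT content, terminals included, in the style of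
`Consts.noDoubleClash_iff_unlinked`.  Call `K ∋ a` (`b, c ∉ K`, `H`-connected from `a`) TERMINAL-LINKED if there are pairwise distinct
`y, y', z, z' ∉ K`, each `H`-adjacent to `K`, `K`-avoiding `H`-walks `y → b`, `z → b`, `y' → c`, `z' → c` with no vertex common to a
`b`-walk and a `c`-walk (disjoint connected `T_b ⊇ {b, y, z}`, `T_c ⊇ {c, y', z'}` in `H − K`), AND `K`-avoiding `H`-walks `y' → b`,
`z → b`, `y → c`, `z' → c` with the same property.
* `Consts.not_quadClash_of_noTerminalLinkage` (`H` ⊇ positive pairs): no terminal-linked cluster of `a` ⟹ no quadruple clash at `(a; b, c)`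
  (the clusters of `b` and `c` in `ω`, resp. `η'`, ARE such sets).
* `Consts.quadClash_of_terminalLinkage` (`H` = positive pairs): a terminal-linked cluster realises a quadruple clash
  (`ω :=` the `H`-pairs inside `K` and the pairs of the first four walks, `η :=` the pairs of the last four).
* `Consts.noQuadClash_iff_noTerminalLinkage`: **NQC(a; b, c) ⟺ no cluster of `a` is terminal-linked to `{b, c}`** — the two-copy
  closed-witness method (Gladkov's Thm. 4.3 with the four boundary witness pairs of gen 18) certifies CSQ at `(a; b, c)` EXACTLY on these
  rooted graphs; forgetting `b, c` (concatenate `y → b ← z`, `y' → c ← z'`) recovers the cross-linkage of `Consts.not_quadClash_of_unlinked₄`.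
* `Fin n` forms `Consts.tripleSplit_of_noTerminalLinkage`, `clusterSquare_le_sq_of_noTerminalLinkage`, `sq_real_split_le_of_noTerminalLinkage`.
References: N. Gladkov, arXiv:2408.08457v2 (2024), Def. 4.2, Thm. 4.3, Lemma 3.1, Example 2.5, Thm. 5.2.
-/

noncomputable section

open Classical

namespace Summit.CriticalPhenomena.PercolationContinuityZ3.Theorems

open MeasureTheory Finset Literature.Probability.LatticeModels Literature.Probability.Percolation
open Literature.Probability.Percolation.DecisionTree Literature.Probability.Percolation.BHK2006
open Literature.Probability.Percolation.TargetExploration Literature.Probability.Percolation.ClusterConditioning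

namespace Consts

section General

variable {V : Type*}

/-- **No quadruple clash unless some cluster of `a` is terminal-linked to `{b, c}`.**  `H` carries the positive pairs.  Suppose that for
every `K ∋ a` with `b, c ∉ K`, `H`-connected from `a`, and all pairwise distinct `y, y', z, z'` outside `K`, each `H`-adjacent to `K`:
EITHER every system of `K`-avoiding `H`-walks `y → b`, `z → b`, `y' → c`, `z' → c` has a vertex common to a `b`-walk and a `c`-walk, OR
every system of `K`-avoiding `H`-walks `y' → b`, `z → b`, `y → c`, `z' → c` has one.  Then the no-quadruple-clash hypothesis of
`Consts.clusterSquare_le_sq_of_noQuadClash_pos` holds at `(a; b, c)`. [folklore; input for Gladkov2024, Thm. 4.3] -/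
theorem not_quadClash_of_noTerminalLinkage (H : SimpleGraph V) (w : Sym2 V → unitInterval) {a b c : V}
    (hH : ∀ u v, u ≠ v → (0 : ℝ) < w s(u, v) → H.Adj u v)
    (hK : ∀ (K : Set V) (y y' z z' : V), a ∈ K → b ∉ K → c ∉ K →
      (∀ T : Set V, a ∈ T → (∀ u x, u ∈ T → H.Adj u x → x ∈ K → x ∈ T) → K ⊆ T) →
      y ∉ K → y' ∉ K → z ∉ K → z' ∉ K →
      (∃ k, k ∈ K ∧ H.Adj k y) → (∃ k, k ∈ K ∧ H.Adj k y') → (∃ k, k ∈ K ∧ H.Adj k z) → (∃ k, k ∈ K ∧ H.Adj k z') →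
      y ≠ y' → y ≠ z → y ≠ z' → y' ≠ z → y' ≠ z' → z ≠ z' →
      (∀ (P₁ : H.Walk y b) (P₂ : H.Walk z b) (Q₁ : H.Walk y' c) (Q₂ : H.Walk z' c),
          (∀ x ∈ P₁.support, x ∉ K) → (∀ x ∈ P₂.support, x ∉ K) → (∀ x ∈ Q₁.support, x ∉ K) → (∀ x ∈ Q₂.support, x ∉ K) →
          ∃ x, (x ∈ P₁.support ∨ x ∈ P₂.support) ∧ (x ∈ Q₁.support ∨ x ∈ Q₂.support)) ∨
      (∀ (P₁ : H.Walk y' b) (P₂ : H.Walk z b) (Q₁ : H.Walk y c) (Q₂ : H.Walk z' c),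
          (∀ x ∈ P₁.support, x ∉ K) → (∀ x ∈ P₂.support, x ∉ K) → (∀ x ∈ Q₁.support, x ∉ K) → (∀ x ∈ Q₂.support, x ∉ K) →
          ∃ x, (x ∈ P₁.support ∨ x ∈ P₂.support) ∧ (x ∈ Q₁.support ∨ x ∈ Q₂.support)))
    {ω η : Set (Sym2 V)} (hω : ∀ e ∈ ω, (0 : ℝ) < w e) (hη : ∀ e ∈ η, (0 : ℝ) < w e)
    (hab : ¬ (openGraph ω).Reachable a b) (hac : ¬ (openGraph ω).Reachable a c) (hbc : ¬ (openGraph ω).Reachable b c)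
    (hbc' : ¬ (openGraph (η \ barOf {a} (setCl ω {a}))).Reachable b c) :
    ¬ ((∃ y k : V, (openGraph ω).Reachable a k ∧ (0 : ℝ) < w s(k, y) ∧ (openGraph ω).Reachable b y ∧
          (openGraph (η \ barOf {a} (setCl ω {a}))).Reachable c y) ∧
       (∃ y k : V, (openGraph ω).Reachable a k ∧ (0 : ℝ) < w s(k, y) ∧ (openGraph ω).Reachable c y ∧
          (openGraph (η \ barOf {a} (setCl ω {a}))).Reachable b y) ∧
       (∃ y k : V, (openGraph ω).Reachable a k ∧ (0 : ℝ) < w s(k, y) ∧ (openGraph ω).Reachable b y ∧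
          (openGraph (η \ barOf {a} (setCl ω {a}))).Reachable b y) ∧
       (∃ y k : V, (openGraph ω).Reachable a k ∧ (0 : ℝ) < w s(k, y) ∧ (openGraph ω).Reachable c y ∧
          (openGraph (η \ barOf {a} (setCl ω {a}))).Reachable c y)) := by
  rintro ⟨⟨y, k, hk, hw, hby, hcy⟩, ⟨y', k', hk', hw', hcy', hby'⟩, ⟨z, k₃, hk₃, hw₃, hbz, hbz'⟩, ⟨z', k₄, hk₄, hw₄, hcz, hcz'⟩⟩
  set θ := η \ barOf {a} (setCl ω {a}) with hθdef
  set K : Set V := {x | (openGraph ω).Reachable a x} with hKdef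
  have hadjH : ∀ (ξ : Set (Sym2 V)), (∀ e ∈ ξ, (0 : ℝ) < w e) → openGraph ξ ≤ H := by
    intro ξ hξ u v huv
    rw [openGraph_adj] at huv
    exact hH u v huv.2 (hξ _ huv.1)
  have hθ : ∀ e ∈ θ, (0 : ℝ) < w e := fun e he => hη e he.1
  have hθK : ∀ u v, (openGraph θ).Adj u v → ¬ (openGraph ω).Reachable a v := by
    intro u v huv hav
    rw [openGraph_adj, hθdef, barOf_setCl_singleton_eq_cutSet] at huv
    exact huv.1.2 ⟨v, Sym2.mem_mk_right u v, hav⟩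
  have hyK : y ∉ K := fun h => hab (h.trans hby.symm)
  have hy'K : y' ∉ K := fun h => hac (h.trans hcy'.symm)
  have hzK : z ∉ K := fun h => hab (h.trans hbz.symm)
  have hz'K : z' ∉ K := fun h => hac (h.trans hcz.symm)
  have hky : H.Adj k y := hH k y (fun h => hyK (h ▸ hk)) hw
  have hky' : H.Adj k' y' := hH k' y' (fun h => hy'K (h ▸ hk')) hw'
  have hk₃z : H.Adj k₃ z := hH k₃ z (fun h => hzK (h ▸ hk₃)) hw₃
  have hk₄z' : H.Adj k₄ z' := hH k₄ z' (fun h => hz'K (h ▸ hk₄)) hw₄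
  have hconn : ∀ T : Set V, a ∈ T → (∀ u x, u ∈ T → H.Adj u x → x ∈ K → x ∈ T) → K ⊆ T := by
    intro T haT hT x hx
    obtain ⟨X⟩ := id hx
    exact mem_of_openWalk_adm H T (fun z => z ∈ K) (fun u z hu huz hz => hT u z hu huz hz) (hadjH ω hω) X haT
      fun z hz => Or.inr (show (openGraph ω).Reachable a z from ⟨X.takeUntil z hz⟩)
  -- the eight walks: `y → b`, `z → b`, `y' → c`, `z' → c` in `ω`; `y' → b`, `z → b`, `y → c`, `z' → c` in `θ`
  obtain ⟨⟨W₁⟩, ⟨W₂⟩, ⟨W₃⟩, ⟨W₄⟩⟩ := And.intro hby.symm (And.intro hbz.symm (And.intro hcy'.symm hcz.symm))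
  obtain ⟨⟨X₁⟩, ⟨X₂⟩, ⟨X₃⟩, ⟨X₄⟩⟩ := And.intro hby'.symm (And.intro hbz'.symm (And.intro hcy.symm hcz'.symm))
  have hW₁ : ∀ x ∈ W₁.support, (openGraph ω).Reachable b x := fun x hx => hby.trans ⟨W₁.takeUntil x hx⟩
  have hW₂ : ∀ x ∈ W₂.support, (openGraph ω).Reachable b x := fun x hx => hbz.trans ⟨W₂.takeUntil x hx⟩
  have hW₃ : ∀ x ∈ W₃.support, (openGraph ω).Reachable c x := fun x hx => hcy'.trans ⟨W₃.takeUntil x hx⟩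
  have hW₄ : ∀ x ∈ W₄.support, (openGraph ω).Reachable c x := fun x hx => hcz.trans ⟨W₄.takeUntil x hx⟩
  have hX₁ : ∀ x ∈ X₁.support, (openGraph θ).Reachable b x := fun x hx => hby'.trans ⟨X₁.takeUntil x hx⟩
  have hX₂ : ∀ x ∈ X₂.support, (openGraph θ).Reachable b x := fun x hx => hbz'.trans ⟨X₂.takeUntil x hx⟩
  have hX₃ : ∀ x ∈ X₃.support, (openGraph θ).Reachable c x := fun x hx => hcy.trans ⟨X₃.takeUntil x hx⟩
  have hX₄ : ∀ x ∈ X₄.support, (openGraph θ).Reachable c x := fun x hx => hcz'.trans ⟨X₄.takeUntil x hx⟩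
  have hX₁K : ∀ x ∈ X₁.support, x ∉ K := not_reachable_of_mem_support a hθK X₁ hy'K
  have hX₂K : ∀ x ∈ X₂.support, x ∉ K := not_reachable_of_mem_support a hθK X₂ hzK
  have hX₃K : ∀ x ∈ X₃.support, x ∉ K := not_reachable_of_mem_support a hθK X₃ hyK
  have hX₄K : ∀ x ∈ X₄.support, x ∉ K := not_reachable_of_mem_support a hθK X₄ hz'K
  rcases hK K y y' z z' (SimpleGraph.Reachable.refl a) hab hac hconn hyK hy'K hzK hz'K ⟨k, hk, hky⟩ ⟨k', hk', hky'⟩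
      ⟨k₃, hk₃, hk₃z⟩ ⟨k₄, hk₄, hk₄z'⟩ (fun h => hbc (hby.trans (by rw [h]; exact hcy'.symm)))
      (fun h => hbc' (hbz'.trans (by rw [← h]; exact hcy.symm))) (fun h => hbc (hby.trans (by rw [h]; exact hcz.symm)))
      (fun h => hbc (hbz.trans (by rw [← h]; exact hcy'.symm))) (fun h => hbc' (hby'.trans (by rw [h]; exact hcz'.symm)))
      (fun h => hbc (hbz.trans (by rw [h]; exact hcz.symm))) with hlink | hlink
  · have e₁ := SimpleGraph.Walk.support_mapLe_eq_support (hadjH ω hω) W₁; have e₂ := W₂.support_mapLe_eq_support (hadjH ω hω)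
    have e₃ := SimpleGraph.Walk.support_mapLe_eq_support (hadjH ω hω) W₃; have e₄ := W₄.support_mapLe_eq_support (hadjH ω hω)
    obtain ⟨x, hxb, hxc⟩ := hlink (W₁.mapLe (hadjH ω hω)) (W₂.mapLe (hadjH ω hω)) (W₃.mapLe (hadjH ω hω))
      (W₄.mapLe (hadjH ω hω))
      (fun x hx => fun hxK => hab (hxK.trans (hW₁ x (by rwa [e₁] at hx)).symm))
      (fun x hx => fun hxK => hab (hxK.trans (hW₂ x (by rwa [e₂] at hx)).symm))
      (fun x hx => fun hxK => hac (hxK.trans (hW₃ x (by rwa [e₃] at hx)).symm))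
      (fun x hx => fun hxK => hac (hxK.trans (hW₄ x (by rwa [e₄] at hx)).symm))
    rw [e₁, e₂] at hxb; rw [e₃, e₄] at hxc
    exact hbc ((hxb.elim (hW₁ x) (hW₂ x)).trans (hxc.elim (hW₃ x) (hW₄ x)).symm)
  · have e₁ := SimpleGraph.Walk.support_mapLe_eq_support (hadjH _ hθ) X₁; have e₂ := X₂.support_mapLe_eq_support (hadjH _ hθ)
    have e₃ := SimpleGraph.Walk.support_mapLe_eq_support (hadjH _ hθ) X₃; have e₄ := X₄.support_mapLe_eq_support (hadjH _ hθ)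
    obtain ⟨x, hxb, hxc⟩ := hlink (X₁.mapLe (hadjH _ hθ)) (X₂.mapLe (hadjH _ hθ)) (X₃.mapLe (hadjH _ hθ))
      (X₄.mapLe (hadjH _ hθ))
      (fun x hx => hX₁K x (by rwa [e₁] at hx)) (fun x hx => hX₂K x (by rwa [e₂] at hx))
      (fun x hx => hX₃K x (by rwa [e₃] at hx)) (fun x hx => hX₄K x (by rwa [e₄] at hx))
    rw [e₁, e₂] at hxb; rw [e₃, e₄] at hxc
    exact hbc' ((hxb.elim (hX₁ x) (hX₂ x)).trans (hxc.elim (hX₃ x) (hX₄ x)).symm)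

/-- **A terminal-linked cluster realises a quadruple clash** (converse of `Consts.not_quadClash_of_noTerminalLinkage`, for `H` the
exact graph of positive pairs): `ω :=` (all `H`-pairs inside `K`) ∪ (pairs of `y → b`, `z → b`, `y' → c`, `z' → c`), `η :=` (pairs of
`y' → b`, `z → b`, `y → c`, `z' → c`); then `C_a(ω) = K`, `a ↮ b`, `a ↮ c`, `b ↮ c` in `ω`, `η' = η ∖ (pairs meeting K) = η`, `b ↮ c`
in `η'`, and `y, y', z, z'` are clash vertices of the four kinds. [folklore; Gladkov2024, Def. 4.2 / Ex. 2.5 for the objects] -/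
theorem quadClash_of_terminalLinkage (H : SimpleGraph V) (w : Sym2 V → unitInterval) {a b c : V}
    (hH' : ∀ u v, H.Adj u v → (0 : ℝ) < w s(u, v)) (K : Set V) (y y' z z' : V) (haK : a ∈ K) (hbK : b ∉ K) (hcK : c ∉ K)
    (hKconn : ∀ x ∈ K, ∃ W : H.Walk a x, ∀ v ∈ W.support, v ∈ K)
    (hky : ∃ k, k ∈ K ∧ H.Adj k y) (hky' : ∃ k, k ∈ K ∧ H.Adj k y') (hkz : ∃ k, k ∈ K ∧ H.Adj k z)
    (hkz' : ∃ k, k ∈ K ∧ H.Adj k z')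
    (P₁ : H.Walk y b) (P₂ : H.Walk z b) (Q₁ : H.Walk y' c) (Q₂ : H.Walk z' c)
    (hP₁ : ∀ x ∈ P₁.support, x ∉ K) (hP₂ : ∀ x ∈ P₂.support, x ∉ K) (hQ₁ : ∀ x ∈ Q₁.support, x ∉ K)
    (hQ₂ : ∀ x ∈ Q₂.support, x ∉ K)
    (hPQ : ∀ x, (x ∈ P₁.support ∨ x ∈ P₂.support) → ¬ (x ∈ Q₁.support ∨ x ∈ Q₂.support))
    (P₃ : H.Walk y' b) (P₄ : H.Walk z b) (Q₃ : H.Walk y c) (Q₄ : H.Walk z' c)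
    (hP₃ : ∀ x ∈ P₃.support, x ∉ K) (hP₄ : ∀ x ∈ P₄.support, x ∉ K) (hQ₃ : ∀ x ∈ Q₃.support, x ∉ K)
    (hQ₄ : ∀ x ∈ Q₄.support, x ∉ K)
    (hPQ' : ∀ x, (x ∈ P₃.support ∨ x ∈ P₄.support) → ¬ (x ∈ Q₃.support ∨ x ∈ Q₄.support)) :
    ∃ ω η : Set (Sym2 V), (∀ e ∈ ω, (0 : ℝ) < w e) ∧ (∀ e ∈ η, (0 : ℝ) < w e) ∧
      ¬ (openGraph ω).Reachable a b ∧ ¬ (openGraph ω).Reachable a c ∧ ¬ (openGraph ω).Reachable b c ∧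
      ¬ (openGraph (η \ barOf {a} (setCl ω {a}))).Reachable b c ∧
      ((∃ y k : V, (openGraph ω).Reachable a k ∧ (0 : ℝ) < w s(k, y) ∧ (openGraph ω).Reachable b y ∧
          (openGraph (η \ barOf {a} (setCl ω {a}))).Reachable c y) ∧
       (∃ y k : V, (openGraph ω).Reachable a k ∧ (0 : ℝ) < w s(k, y) ∧ (openGraph ω).Reachable c y ∧
          (openGraph (η \ barOf {a} (setCl ω {a}))).Reachable b y) ∧
       (∃ y k : V, (openGraph ω).Reachable a k ∧ (0 : ℝ) < w s(k, y) ∧ (openGraph ω).Reachable b y ∧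
          (openGraph (η \ barOf {a} (setCl ω {a}))).Reachable b y) ∧
       (∃ y k : V, (openGraph ω).Reachable a k ∧ (0 : ℝ) < w s(k, y) ∧ (openGraph ω).Reachable c y ∧
          (openGraph (η \ barOf {a} (setCl ω {a}))).Reachable c y)) := by
  -- positivity of walk pairs
  have hpos : ∀ {u v : V} (P : H.Walk u v), ∀ e ∈ P.edges, (0 : ℝ) < w e := by
    intro u v P e he
    have he' := P.edges_subset_edgeSet he
    revert he'
    induction e using Sym2.ind with
    | h p q => intro hpq; exact hH' p q (by rwa [SimpleGraph.mem_edgeSet] at hpq)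
  set ωK : Set (Sym2 V) := {e | ∃ u v, e = s(u, v) ∧ u ∈ K ∧ v ∈ K ∧ H.Adj u v} with hωK
  set ω : Set (Sym2 V) :=
    ωK ∪ (({e | e ∈ P₁.edges} ∪ {e | e ∈ P₂.edges}) ∪ ({e | e ∈ Q₁.edges} ∪ {e | e ∈ Q₂.edges})) with hωdef
  set η : Set (Sym2 V) := ({e | e ∈ P₃.edges} ∪ {e | e ∈ P₄.edges}) ∪ ({e | e ∈ Q₃.edges} ∪ {e | e ∈ Q₄.edges}) with hηdef
  -- the vertex classes: `K`, the `b`-side `Sb`, the `c`-side `Sc` (first system), `Sb'` (second system)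
  set Sb : Set V := {x | x ∈ P₁.support ∨ x ∈ P₂.support} with hSb
  set Sc : Set V := {x | x ∈ Q₁.support ∨ x ∈ Q₂.support} with hSc
  set Sb' : Set V := {x | x ∈ P₃.support ∨ x ∈ P₄.support} with hSb'
  have hSbK : ∀ x ∈ Sb, x ∉ K := fun x hx => hx.elim (hP₁ x) (hP₂ x)
  have hScK : ∀ x ∈ Sc, x ∉ K := fun x hx => hx.elim (hQ₁ x) (hQ₂ x)
  have hωpos : ∀ e ∈ ω, (0 : ℝ) < w e := by
    rintro e (⟨u, v, rfl, -, -, huv⟩ | (he | he) | (he | he))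
    exacts [hH' u v huv, hpos P₁ e he, hpos P₂ e he, hpos Q₁ e he, hpos Q₂ e he]
  have hηpos : ∀ e ∈ η, (0 : ℝ) < w e := by
    rintro e ((he | he) | (he | he))
    exacts [hpos P₃ e he, hpos P₄ e he, hpos Q₃ e he, hpos Q₄ e he]
  -- an `ω`-edge at a vertex: inside `K`, or inside `Sb`, or inside `Sc`
  have hωadj : ∀ u v, (openGraph ω).Adj u v → (u ∈ K ∧ v ∈ K) ∨ (u ∈ Sb ∧ v ∈ Sb) ∨ (u ∈ Sc ∧ v ∈ Sc) := by
    intro u v huv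
    have h := ((openGraph_adj ω u v).1 huv).1
    rcases h with ⟨u', v', he, hu', hv', -⟩ | (he | he) | (he | he)
    · left
      rcases Sym2.eq_iff.1 he with ⟨rfl, rfl⟩ | ⟨rfl, rfl⟩
      exacts [⟨hu', hv'⟩, ⟨hv', hu'⟩]
    · exact Or.inr (Or.inl ⟨Or.inl (P₁.fst_mem_support_of_mem_edges he), Or.inl (P₁.snd_mem_support_of_mem_edges he)⟩)
    · exact Or.inr (Or.inl ⟨Or.inr (P₂.fst_mem_support_of_mem_edges he), Or.inr (P₂.snd_mem_support_of_mem_edges he)⟩)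
    · exact Or.inr (Or.inr ⟨Or.inl (Q₁.fst_mem_support_of_mem_edges he), Or.inl (Q₁.snd_mem_support_of_mem_edges he)⟩)
    · exact Or.inr (Or.inr ⟨Or.inr (Q₂.fst_mem_support_of_mem_edges he), Or.inr (Q₂.snd_mem_support_of_mem_edges he)⟩)
  -- `K`, `Sb`, `Sc` are closed under `ω`-adjacency
  have hKcl : ∀ u v, u ∈ K → (openGraph ω).Adj u v → v ∈ K := by
    intro u v hu huv
    rcases hωadj u v huv with ⟨-, hv⟩ | ⟨hu1, -⟩ | ⟨hu2, -⟩
    exacts [hv, absurd hu (hSbK u hu1), absurd hu (hScK u hu2)]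
  have hSbcl : ∀ u v, u ∈ Sb → (openGraph ω).Adj u v → v ∈ Sb := by
    intro u v hu huv
    rcases hωadj u v huv with ⟨huK, -⟩ | ⟨-, hv⟩ | ⟨hu2, -⟩
    exacts [absurd huK (hSbK u hu), hv, absurd hu2 (hPQ u hu)]
  have hCa : ∀ x, (openGraph ω).Reachable a x → x ∈ K := fun x hx => mem_of_reachable_of_closed K hKcl haK hx
  have hCb : ∀ x, (openGraph ω).Reachable b x → x ∈ Sb := fun x hx =>
    mem_of_reachable_of_closed _ hSbcl (Or.inl P₁.end_mem_support) hx
  -- reachability inside `K` and along the walks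
  have hK_reach : ∀ x ∈ K, (openGraph ω).Reachable a x := by
    intro x hx
    obtain ⟨W, hW⟩ := hKconn x hx
    refine reachable_openGraph_of_walk W fun e he => Or.inl ?_
    revert he
    induction e using Sym2.ind with
    | h p q =>
      intro he
      exact ⟨p, q, rfl, hW p (W.fst_mem_support_of_mem_edges he), hW q (W.snd_mem_support_of_mem_edges he),
        by have := W.edges_subset_edgeSet he; rwa [SimpleGraph.mem_edgeSet] at this⟩
  have hby : (openGraph ω).Reachable b y := (reachable_openGraph_of_walk P₁ fun e he => Or.inr (Or.inl (Or.inl he))).symm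
  have hbz : (openGraph ω).Reachable b z := (reachable_openGraph_of_walk P₂ fun e he => Or.inr (Or.inl (Or.inr he))).symm
  have hcy' : (openGraph ω).Reachable c y' := (reachable_openGraph_of_walk Q₁ fun e he => Or.inr (Or.inr (Or.inl he))).symm
  have hcz' : (openGraph ω).Reachable c z' := (reachable_openGraph_of_walk Q₂ fun e he => Or.inr (Or.inr (Or.inr he))).symm
  -- the deleted pairs do not meet `η`: `η' = η`
  have hθ : η \ barOf {a} (setCl ω {a}) = η := by
    rw [barOf_setCl_singleton_eq_cutSet]
    ext e
    simp only [Set.mem_sdiff, and_iff_left_iff_imp]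
    rintro he ⟨u, hue, hau⟩
    have huK : u ∈ K := hCa u hau
    rcases he with (he | he) | (he | he)
    · exact hP₃ u (SimpleGraph.Walk.mem_support_of_mem_edges he hue) huK
    · exact hP₄ u (SimpleGraph.Walk.mem_support_of_mem_edges he hue) huK
    · exact hQ₃ u (SimpleGraph.Walk.mem_support_of_mem_edges he hue) huK
    · exact hQ₄ u (SimpleGraph.Walk.mem_support_of_mem_edges he hue) huK
  -- `η`-adjacency: inside `Sb'` or inside `Sc'`; `Sb'` is closed
  have hSb'cl : ∀ u v, u ∈ Sb' → (openGraph η).Adj u v → v ∈ Sb' := by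
    intro u v hu huv
    rcases ((openGraph_adj η u v).1 huv).1 with (he | he) | (he | he)
    · exact Or.inl (P₃.snd_mem_support_of_mem_edges he)
    · exact Or.inr (P₄.snd_mem_support_of_mem_edges he)
    · exact absurd (Or.inl (Q₃.fst_mem_support_of_mem_edges he)) (hPQ' u hu)
    · exact absurd (Or.inr (Q₄.fst_mem_support_of_mem_edges he)) (hPQ' u hu)
  have hCbη : ∀ x, (openGraph η).Reachable b x → x ∈ Sb' := fun x hx =>
    mem_of_reachable_of_closed _ hSb'cl (Or.inl P₃.end_mem_support) hx
  have hby'η : (openGraph η).Reachable b y' := (reachable_openGraph_of_walk P₃ fun e he => Or.inl (Or.inl he)).symm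
  have hbzη : (openGraph η).Reachable b z := (reachable_openGraph_of_walk P₄ fun e he => Or.inl (Or.inr he)).symm
  have hcyη : (openGraph η).Reachable c y := (reachable_openGraph_of_walk Q₃ fun e he => Or.inr (Or.inl he)).symm
  have hcz'η : (openGraph η).Reachable c z' := (reachable_openGraph_of_walk Q₄ fun e he => Or.inr (Or.inr he)).symm
  obtain ⟨⟨k₁, hk₁K, hk₁y⟩, ⟨k₂, hk₂K, hk₂y'⟩, ⟨k₃, hk₃K, hk₃z⟩, ⟨k₄, hk₄K, hk₄z'⟩⟩ :=
    And.intro hky (And.intro hky' (And.intro hkz hkz'))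
  refine ⟨ω, η, hωpos, hηpos, fun h => hbK (hCa b h), fun h => hcK (hCa c h),
    fun h => hPQ c (hCb c h) (Or.inl Q₁.end_mem_support), ?_, ?_⟩
  · rw [hθ]; exact fun h => hPQ' c (hCbη c h) (Or.inl Q₃.end_mem_support)
  · rw [hθ]
    exact ⟨⟨y, k₁, hK_reach k₁ hk₁K, hH' k₁ y hk₁y, hby, hcyη⟩, ⟨y', k₂, hK_reach k₂ hk₂K, hH' k₂ y' hk₂y', hcy', hby'η⟩,
      ⟨z, k₃, hK_reach k₃ hk₃K, hH' k₃ z hk₃z, hbz, hbzη⟩, ⟨z', k₄, hK_reach k₄ hk₄K, hH' k₄ z' hk₄z', hcz', hcz'η⟩⟩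

/-- **NQC(a; b, c) ⟺ no cluster of `a` is terminal-linked to `{b, c}`**, for `H` the exact graph of positive pairs (the forward
direction is `Consts.not_quadClash_of_noTerminalLinkage`, with `K`-connectivity phrased by walks inside `K`; the backward direction is
`Consts.quadClash_of_terminalLinkage`).  This is the exact reach of the two-copy closed-witness method with the four boundary witness
pairs of `…ConstsClusterSquareQuadClash.lean`. [folklore; input for Gladkov2024, Thm. 4.3] -/
theorem noQuadClash_iff_noTerminalLinkage (H : SimpleGraph V) (w : Sym2 V → unitInterval) {a b c : V}
    (hH : ∀ u v, u ≠ v → ((0 : ℝ) < w s(u, v) ↔ H.Adj u v)) :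
    (∀ ω η : Set (Sym2 V), (∀ e ∈ ω, (0 : ℝ) < w e) → (∀ e ∈ η, (0 : ℝ) < w e) →
      ¬ (openGraph ω).Reachable a b → ¬ (openGraph ω).Reachable a c →
      ¬ (openGraph ω).Reachable b c → ¬ (openGraph (η \ barOf {a} (setCl ω {a}))).Reachable b c →
      ¬ ((∃ y k : V, (openGraph ω).Reachable a k ∧ (0 : ℝ) < w s(k, y) ∧ (openGraph ω).Reachable b y ∧
            (openGraph (η \ barOf {a} (setCl ω {a}))).Reachable c y) ∧
         (∃ y k : V, (openGraph ω).Reachable a k ∧ (0 : ℝ) < w s(k, y) ∧ (openGraph ω).Reachable c y ∧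
            (openGraph (η \ barOf {a} (setCl ω {a}))).Reachable b y) ∧
         (∃ y k : V, (openGraph ω).Reachable a k ∧ (0 : ℝ) < w s(k, y) ∧ (openGraph ω).Reachable b y ∧
            (openGraph (η \ barOf {a} (setCl ω {a}))).Reachable b y) ∧
         (∃ y k : V, (openGraph ω).Reachable a k ∧ (0 : ℝ) < w s(k, y) ∧ (openGraph ω).Reachable c y ∧
            (openGraph (η \ barOf {a} (setCl ω {a}))).Reachable c y))) ↔
    (∀ (K : Set V) (y y' z z' : V), a ∈ K → b ∉ K → c ∉ K → (∀ x ∈ K, ∃ W : H.Walk a x, ∀ v ∈ W.support, v ∈ K) →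
      y ∉ K → y' ∉ K → z ∉ K → z' ∉ K →
      (∃ k, k ∈ K ∧ H.Adj k y) → (∃ k, k ∈ K ∧ H.Adj k y') → (∃ k, k ∈ K ∧ H.Adj k z) → (∃ k, k ∈ K ∧ H.Adj k z') →
      y ≠ y' → y ≠ z → y ≠ z' → y' ≠ z → y' ≠ z' → z ≠ z' →
      ∀ (P₁ : H.Walk y b) (P₂ : H.Walk z b) (Q₁ : H.Walk y' c) (Q₂ : H.Walk z' c)
        (P₃ : H.Walk y' b) (P₄ : H.Walk z b) (Q₃ : H.Walk y c) (Q₄ : H.Walk z' c),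
        (∀ x ∈ P₁.support, x ∉ K) → (∀ x ∈ P₂.support, x ∉ K) → (∀ x ∈ Q₁.support, x ∉ K) → (∀ x ∈ Q₂.support, x ∉ K) →
        (∀ x ∈ P₃.support, x ∉ K) → (∀ x ∈ P₄.support, x ∉ K) → (∀ x ∈ Q₃.support, x ∉ K) → (∀ x ∈ Q₄.support, x ∉ K) →
        (∃ x, (x ∈ P₁.support ∨ x ∈ P₂.support) ∧ (x ∈ Q₁.support ∨ x ∈ Q₂.support)) ∨
        (∃ x, (x ∈ P₃.support ∨ x ∈ P₄.support) ∧ (x ∈ Q₃.support ∨ x ∈ Q₄.support))) := by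
  constructor
  · intro hnqc K y y' z z' haK hbK hcK hKconn hyK hy'K hzK hz'K hky hky' hkz hkz' _ _ _ _ _ _ P₁ P₂ Q₁ Q₂ P₃ P₄ Q₃ Q₄
      hP₁ hP₂ hQ₁ hQ₂ hP₃ hP₄ hQ₃ hQ₄
    by_contra hcon
    simp only [not_or, not_exists, not_and] at hcon
    obtain ⟨ω, η, hω, hη, hab, hac, hbc, hbc', hcl⟩ := quadClash_of_terminalLinkage H w (fun u v huv => (hH u v huv.ne).2 huv)
      K y y' z z' haK hbK hcK hKconn hky hky' hkz hkz' P₁ P₂ Q₁ Q₂ hP₁ hP₂ hQ₁ hQ₂ (fun x hx hx' => hx'.elim (hcon.1 x hx).1 (hcon.1 x hx).2)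
      P₃ P₄ Q₃ Q₄ hP₃ hP₄ hQ₃ hQ₄ (fun x hx hx' => hx'.elim (hcon.2 x hx).1 (hcon.2 x hx).2)
    exact hnqc ω η hω hη hab hac hbc hbc' hcl
  · intro hK ω η hω hη hab hac hbc hbc'
    refine not_quadClash_of_noTerminalLinkage H w (fun u v huv hw => (hH u v huv).1 hw)
      (fun K y y' z z' haK hbK hcK hconn hyK hy'K hzK hz'K hky hky' hkz hkz' h₁ h₂ h₃ h₄ h₅ h₆ => ?_) hω hη hab hac hbc hbc'
    -- connectivity of `K` by walks inside `K`, from the closure certificate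
    have hKconn : ∀ x ∈ K, ∃ W : H.Walk a x, ∀ v ∈ W.support, v ∈ K := by
      have hT := hconn {x | ∃ W : H.Walk a x, ∀ v ∈ W.support, v ∈ K} ⟨SimpleGraph.Walk.nil, by simpa using haK⟩
        (by
          rintro u x ⟨W, hW⟩ hux hxK
          refine ⟨W.append (SimpleGraph.Walk.cons hux SimpleGraph.Walk.nil), fun v hv => ?_⟩
          rw [SimpleGraph.Walk.support_append] at hv
          simp only [SimpleGraph.Walk.support_cons, SimpleGraph.Walk.support_nil, List.tail_cons, List.mem_append,
            List.mem_singleton] at hv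
          rcases hv with hv | rfl
          exacts [hW v hv, hxK])
      exact fun x hx => hT hx
    by_cases h : ∀ (P₁ : H.Walk y b) (P₂ : H.Walk z b) (Q₁ : H.Walk y' c) (Q₂ : H.Walk z' c),
        (∀ x ∈ P₁.support, x ∉ K) → (∀ x ∈ P₂.support, x ∉ K) → (∀ x ∈ Q₁.support, x ∉ K) → (∀ x ∈ Q₂.support, x ∉ K) →
        ∃ x, (x ∈ P₁.support ∨ x ∈ P₂.support) ∧ (x ∈ Q₁.support ∨ x ∈ Q₂.support)
    · exact Or.inl h
    · right
      intro P₃ P₄ Q₃ Q₄ hP₃ hP₄ hQ₃ hQ₄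
      simp only [not_forall, not_exists, not_and] at h
      obtain ⟨P₁, P₂, Q₁, Q₂, hP₁, hP₂, hQ₁, hQ₂, hdis⟩ := h
      rcases hK K y y' z z' haK hbK hcK hKconn hyK hy'K hzK hz'K hky hky' hkz hkz' h₁ h₂ h₃ h₄ h₅ h₆ P₁ P₂ Q₁ Q₂ P₃ P₄ Q₃ Q₄
          hP₁ hP₂ hQ₁ hQ₂ hP₃ hP₄ hQ₃ hQ₄ with ⟨x, hx, hx'⟩ | hx
      · exact absurd hx' (hdis x hx)
      · exact hx

end General


/-- **TS for `{a, b, c}` when no cluster of `a` is terminal-linked to `{b, c}`** (`H` ⊇ positive pairs; hypothesis as in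
`Consts.not_quadClash_of_noTerminalLinkage`): `μ(a|b|c)² ≤ μ(a↮b)·μ(a↮c)·μ(b↮c)`.  This is the widest class reachable by the two-copy
method at the root `a`; it contains every class of gens 17–23 at that root.
[cite: Gladkov2024, Thm. 4.3 and Thm. 5.2; derived here] -/
theorem tripleSplit_of_noTerminalLinkage {n : ℕ} (w : Sym2 (Fin n) → unitInterval) (a b c : Fin n) (H : SimpleGraph (Fin n))
    (hH : ∀ u v, u ≠ v → (0 : ℝ) < w s(u, v) → H.Adj u v)
    (hK : ∀ (K : Set (Fin n)) (y y' z z' : Fin n), a ∈ K → b ∉ K → c ∉ K →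
      (∀ T : Set (Fin n), a ∈ T → (∀ u x, u ∈ T → H.Adj u x → x ∈ K → x ∈ T) → K ⊆ T) →
      y ∉ K → y' ∉ K → z ∉ K → z' ∉ K →
      (∃ k, k ∈ K ∧ H.Adj k y) → (∃ k, k ∈ K ∧ H.Adj k y') → (∃ k, k ∈ K ∧ H.Adj k z) → (∃ k, k ∈ K ∧ H.Adj k z') →
      y ≠ y' → y ≠ z → y ≠ z' → y' ≠ z → y' ≠ z' → z ≠ z' →
      (∀ (P₁ : H.Walk y b) (P₂ : H.Walk z b) (Q₁ : H.Walk y' c) (Q₂ : H.Walk z' c),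
          (∀ x ∈ P₁.support, x ∉ K) → (∀ x ∈ P₂.support, x ∉ K) → (∀ x ∈ Q₁.support, x ∉ K) → (∀ x ∈ Q₂.support, x ∉ K) →
          ∃ x, (x ∈ P₁.support ∨ x ∈ P₂.support) ∧ (x ∈ Q₁.support ∨ x ∈ Q₂.support)) ∨
      (∀ (P₁ : H.Walk y' b) (P₂ : H.Walk z b) (Q₁ : H.Walk y c) (Q₂ : H.Walk z' c),
          (∀ x ∈ P₁.support, x ∉ K) → (∀ x ∈ P₂.support, x ∉ K) → (∀ x ∈ Q₁.support, x ∉ K) → (∀ x ∈ Q₂.support, x ∉ K) →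
          ∃ x, (x ∈ P₁.support ∨ x ∈ P₂.support) ∧ (x ∈ Q₁.support ∨ x ∈ Q₂.support))) :
    (prodBernoulli w).real ((openConn a b)ᶜ ∩ (openConn a c)ᶜ ∩ (openConn b c)ᶜ) ^ 2 ≤
      (prodBernoulli w).real (openConn a b)ᶜ * (prodBernoulli w).real (openConn a c)ᶜ *
        (prodBernoulli w).real (openConn b c)ᶜ :=
  tripleSplit_of_noQuadClash_pos w a b c fun _ _ hω hη hab hac hbc hbc' =>
    not_quadClash_of_noTerminalLinkage H w hH hK hω hη hab hac hbc hbc'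

/-- **CSQ at `(a; b, c)` when no cluster of `a` is terminal-linked to `{b, c}`.** [cite: Gladkov2024, Thm. 4.3; derived here] -/
theorem clusterSquare_le_sq_of_noTerminalLinkage {n : ℕ} (w : Sym2 (Fin n) → unitInterval) (a b c : Fin n)
    (H : SimpleGraph (Fin n)) (hH : ∀ u v, u ≠ v → (0 : ℝ) < w s(u, v) → H.Adj u v)
    (hK : ∀ (K : Set (Fin n)) (y y' z z' : Fin n), a ∈ K → b ∉ K → c ∉ K →
      (∀ T : Set (Fin n), a ∈ T → (∀ u x, u ∈ T → H.Adj u x → x ∈ K → x ∈ T) → K ⊆ T) →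
      y ∉ K → y' ∉ K → z ∉ K → z' ∉ K →
      (∃ k, k ∈ K ∧ H.Adj k y) → (∃ k, k ∈ K ∧ H.Adj k y') → (∃ k, k ∈ K ∧ H.Adj k z) → (∃ k, k ∈ K ∧ H.Adj k z') →
      y ≠ y' → y ≠ z → y ≠ z' → y' ≠ z → y' ≠ z' → z ≠ z' →
      (∀ (P₁ : H.Walk y b) (P₂ : H.Walk z b) (Q₁ : H.Walk y' c) (Q₂ : H.Walk z' c),
          (∀ x ∈ P₁.support, x ∉ K) → (∀ x ∈ P₂.support, x ∉ K) → (∀ x ∈ Q₁.support, x ∉ K) → (∀ x ∈ Q₂.support, x ∉ K) →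
          ∃ x, (x ∈ P₁.support ∨ x ∈ P₂.support) ∧ (x ∈ Q₁.support ∨ x ∈ Q₂.support)) ∨
      (∀ (P₁ : H.Walk y' b) (P₂ : H.Walk z b) (Q₁ : H.Walk y c) (Q₂ : H.Walk z' c),
          (∀ x ∈ P₁.support, x ∉ K) → (∀ x ∈ P₂.support, x ∉ K) → (∀ x ∈ Q₁.support, x ∉ K) → (∀ x ∈ Q₂.support, x ∉ K) →
          ∃ x, (x ∈ P₁.support ∨ x ∈ P₂.support) ∧ (x ∈ Q₁.support ∨ x ∈ Q₂.support))) :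
    clusterSquare w a b c ≤ (prodBernoulli w).real (openConn b c)ᶜ ^ 2 :=
  clusterSquare_le_sq_of_noQuadClash_pos w a b c fun _ _ hω hη hab hac hbc hbc' =>
    not_quadClash_of_noTerminalLinkage H w hH hK hω hη hab hac hbc hbc'

/-- **DUU at `(a; b, c)` when no cluster of `a` is terminal-linked to `{b, c}`.** [cite: Gladkov2024, Thm. 5.2 and Thm. 4.3; derived here] -/
theorem sq_real_split_le_of_noTerminalLinkage {n : ℕ} (w : Sym2 (Fin n) → unitInterval) (a b c : Fin n)
    (H : SimpleGraph (Fin n)) (hH : ∀ u v, u ≠ v → (0 : ℝ) < w s(u, v) → H.Adj u v)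
    (hK : ∀ (K : Set (Fin n)) (y y' z z' : Fin n), a ∈ K → b ∉ K → c ∉ K →
      (∀ T : Set (Fin n), a ∈ T → (∀ u x, u ∈ T → H.Adj u x → x ∈ K → x ∈ T) → K ⊆ T) →
      y ∉ K → y' ∉ K → z ∉ K → z' ∉ K →
      (∃ k, k ∈ K ∧ H.Adj k y) → (∃ k, k ∈ K ∧ H.Adj k y') → (∃ k, k ∈ K ∧ H.Adj k z) → (∃ k, k ∈ K ∧ H.Adj k z') →
      y ≠ y' → y ≠ z → y ≠ z' → y' ≠ z → y' ≠ z' → z ≠ z' →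
      (∀ (P₁ : H.Walk y b) (P₂ : H.Walk z b) (Q₁ : H.Walk y' c) (Q₂ : H.Walk z' c),
          (∀ x ∈ P₁.support, x ∉ K) → (∀ x ∈ P₂.support, x ∉ K) → (∀ x ∈ Q₁.support, x ∉ K) → (∀ x ∈ Q₂.support, x ∉ K) →
          ∃ x, (x ∈ P₁.support ∨ x ∈ P₂.support) ∧ (x ∈ Q₁.support ∨ x ∈ Q₂.support)) ∨
      (∀ (P₁ : H.Walk y' b) (P₂ : H.Walk z b) (Q₁ : H.Walk y c) (Q₂ : H.Walk z' c),
          (∀ x ∈ P₁.support, x ∉ K) → (∀ x ∈ P₂.support, x ∉ K) → (∀ x ∈ Q₁.support, x ∉ K) → (∀ x ∈ Q₂.support, x ∉ K) →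
          ∃ x, (x ∈ P₁.support ∨ x ∈ P₂.support) ∧ (x ∈ Q₁.support ∨ x ∈ Q₂.support))) :
    (prodBernoulli w).real ((openConn a b)ᶜ ∩ (openConn a c)ᶜ ∩ (openConn b c)ᶜ) ^ 2 ≤
      (prodBernoulli w).real ((openConn a b)ᶜ ∩ (openConn a c)ᶜ) * (prodBernoulli w).real (openConn b c)ᶜ ^ 2 :=
  sq_real_split_le_of_noQuadClash_pos w a b c fun _ _ hω hη hab hac hbc hbc' =>
    not_quadClash_of_noTerminalLinkage H w hH hK hω hη hab hac hbc hbc'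

end Consts

end Summit.CriticalPhenomena.PercolationContinuityZ3.Theorems
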